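import Summits.ResolutionOfSingularities.ResolutionOfSingularities.Theorems.EquisingularLiftEquisingularLiftNatCarrierRigidity
import Summits.ResolutionOfSingularities.ResolutionOfSingularities.Theorems.EquisingularLiftEquisingularLiftSplit
import HarnessLib

/-!
# [OURS · L1 W4.5(b) · EL♮] CARRIER DICHOTOMY (carrier rigidity (b), any centre): an irreducible closed set of a blow-up is
# either INSIDE the exceptional locus or THE STRICT TRANSFORM of its image (crux `EquisingularLiftNat` = stmt-20038)

HONEST FRAMING. OURS (cell res-hironaka, crux chain w45b, slot W4.5(b)); NOT a statement of any manuscript; AI-written,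
weaker than expert review. Helper `--supports stmt-ResolutionOfSingularities-20038 --as helper`; own-lineage sequel of
`…NatCarrierRigidity.lean` (p505871, carrier rigidity (a)); plan text L/w45b/CRUX-PLAN.md v3 §1.7 «CARRIER RIGIDITY (b) CURVE
carriers: … the image `D′` of `C` in `P_j` is an `O`-flat relative curve with `D′_k ⊆ C′_k` — EITHER `D′ = C′` (in-carrier) OR
`D′ ≠ C′` … and `C = St_{C′}(D′)`».

THE STATEMENTS (set-level, any blow-up `τ : X′ → X` of a locally Noetherian `X` along ANY ideal sheaf `I`):
* `preimage_image_diff_support_subset` — off the centre `τ` is injective: `τ⁻¹(τ(C) ∖ supp I) ⊆ C` for every `C ⊆ X′`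
  (`IsBlowup.isIso_compl` + `Split.existsUnique_preimage`).
* `subset_preimage_support_or_eq_strictTransform` — **DICHOTOMY**: a closed irreducible `C ⊆ X′` is EITHER contained in the
  exceptional locus `τ⁻¹(supp I)` OR equal to the strict transform `closure τ⁻¹(τ(C) ∖ supp I)` of its image `D = τ(C)`, which is
  then closed (`IsBlowup.isProper`), irreducible and not inside `supp I`.
* `subset_preimage_support_or_eq_strictTransform_of_specialFibre_subset` — with a «special fibre» `V(ϖ)` (`ϖ ∈ Γ(X, 𝒪_X)`): if `C` is
  HORIZONTAL (`C ⊄ τ⁻¹V(ϖ)`) and its special fibre lies in the exceptional locus, then in the second alternative `D` is horizontal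
  and `D ∩ V(ϖ) ⊆ supp I ∩ V(ϖ)` — «`D′` is an `O`-model of a sub-union of the components of the centre's special fibre» (§1.7 (b));
  carrier rigidity (a) (p505871) is the case where `supp I ∩ V(ϖ)` is one point and `C` has infinite special fibre, which excludes the
  second alternative by a dimension count.
* `not_support_subset_preimage_closedPoint_of_flat` (flat over a DVR ⇒ horizontal) and
  `support_subset_preimage_or_eq_strictTransform_of_flat` — the same dichotomy in the EL♮ currency (`O` DVR, `r : P → Spec O`,
  `IsBlowup τ I` for ANY centre, `C : Bl.IdealSheafData` with `V(C)` integral and `V(C) → Spec O` flat).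

References: Görtz–Wedhorn I Prop. 13.91 (3) (blow-up is an isomorphism off the centre) and Prop. 13.96 [GortzWedhorn2020]; Stacks
080E [StacksProject] — through the cited tree files. OURS planning text (index only): L/w45b/CRUX-PLAN.md v3 §1.7.
-/

set_option linter.dupNamespace false -- mandated namespace `Summit.<Summit>.<Problem>` of this single-conjunct summit

open CategoryTheory AlgebraicGeometry TopologicalSpace Topology
open AlgebraicGeometry.Scheme.IdealSheafData Literature.AlgebraicGeometry.Resolution
open Summit.ResolutionOfSingularities.ResolutionOfSingularities.Theses.EquisingularLift.Split

namespace Summit.ResolutionOfSingularities.ResolutionOfSingularities.Cruxes.EquisingularLiftNat.Sections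

/-- **Off the centre a blow-up is injective**: for a blow-up `τ : X′ → X` along `I` and any `C ⊆ X′`,
`τ⁻¹(τ(C) ∖ supp I) ⊆ C` (the restriction of `τ` over the complement of `supp I` is an isomorphism, GW I Prop. 13.91 (3)).
[cite: GortzWedhorn2020, Prop. 13.91 (3)] -/
theorem preimage_image_diff_support_subset {X X' : Scheme.{0}} (τ : X' ⟶ X) (I : X.IdealSheafData) (hτ : IsBlowup τ I)
    (C : Set X') : τ ⁻¹' (τ '' C \ (I.support : Set X)) ⊆ C := by
  rintro x ⟨⟨c, hc, hcx⟩, hxI⟩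
  obtain ⟨y, -, huniq⟩ := existsUnique_preimage τ hτ.isIso_compl (y := τ x) hxI
  have h1 : x = y := huniq x rfl
  have h2 : c = y := huniq c hcx
  rw [h1, ← h2]
  exact hc

/-- **[OURS · L1 W4.5(b)] CARRIER DICHOTOMY (carrier rigidity (b), set-level, any centre).** Let `τ : X′ → X` be a blow-up of the
locally Noetherian scheme `X` along an ideal sheaf `I` and `C ⊆ X′` closed and irreducible. Then EITHER `C ⊆ τ⁻¹(supp I)` (in the
carrier), OR the image `D := τ(C)` is closed and irreducible, `D ⊄ supp I`, and `C` is the strict transform of `D`: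
`C = closure τ⁻¹(D ∖ supp I)`. (The generic point of `C` is either in the closed exceptional locus or not; in the second case `C` is the
closure of its points off the centre, where `τ` is injective.) NOT a statement of the manuscript. [cite: GortzWedhorn2020, Prop. 13.91 (3)] -/
theorem subset_preimage_support_or_eq_strictTransform {X X' : Scheme.{0}} [IsLocallyNoetherian X] (τ : X' ⟶ X)
    (I : X.IdealSheafData) (hτ : IsBlowup τ I) {C : Set X'} (hC : IsClosed C) (hCirr : IsIrreducible C) :
    C ⊆ τ ⁻¹' (I.support : Set X) ∨
      (IsClosed (τ '' C) ∧ IsIrreducible (τ '' C) ∧ ¬ τ '' C ⊆ (I.support : Set X) ∧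
        C = closure (τ ⁻¹' (τ '' C \ (I.support : Set X)))) := by
  haveI : IsProper τ := hτ.isProper
  obtain ⟨γ, hγ⟩ := QuasiSober.sober hCirr hC
  by_cases hγE : γ ∈ τ ⁻¹' (I.support : Set X)
  · exact Or.inl ((hγ.mem_closed_set_iff (I.support.isClosed.preimage τ.continuous)).mp hγE)
  · refine Or.inr ⟨τ.isClosedMap _ hC, hCirr.image _ τ.continuous.continuousOn,
      fun h => hγE (h ⟨γ, hγ.mem, rfl⟩), le_antisymm ?_ ?_⟩
    · have h1 : γ ∈ τ ⁻¹' (τ '' C \ (I.support : Set X)) := ⟨⟨γ, hγ.mem, rfl⟩, hγE⟩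
      have h2 : closure ({γ} : Set X') ⊆ closure (τ ⁻¹' (τ '' C \ (I.support : Set X))) :=
        closure_mono (Set.singleton_subset_iff.mpr h1)
      rwa [hγ.def] at h2
    · exact closure_minimal (preimage_image_diff_support_subset τ I hτ C) hC

/-- **[OURS · L1 W4.5(b)] CARRIER DICHOTOMY with a special fibre (CRUX-PLAN v3 §1.7 (b)).** In the setting of
`subset_preimage_support_or_eq_strictTransform`, let `ϖ ∈ Γ(X, 𝒪_X)` («special fibre» `V(ϖ)`) and suppose `C` is HORIZONTAL
(`C ⊄ τ⁻¹V(ϖ)`) with special fibre `C ∩ τ⁻¹V(ϖ)` inside the exceptional locus `τ⁻¹(supp I)`. Then EITHER `C ⊆ τ⁻¹(supp I)`, OR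
`C` is the strict transform of its image `D = τ(C)`, which is closed, irreducible, HORIZONTAL (`D ⊄ V(ϖ)`), not inside `supp I`, and
whose special fibre lies in that of the centre: `D ∩ V(ϖ) ⊆ supp I ∩ V(ϖ)` («`D′` is an `O`-model of a sub-union of the components of
`C′_k`»). Carrier rigidity (a) (`subset_preimage_support_of_specialFibre_subset`, p505871) excludes the second alternative when
`supp I ∩ V(ϖ)` is a single point and the special fibre of `C` is infinite. NOT a statement of the manuscript.
[cite: GortzWedhorn2020, Prop. 13.91 (3)] -/
theorem subset_preimage_support_or_eq_strictTransform_of_specialFibre_subset {X X' : Scheme.{0}} [IsLocallyNoetherian X]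
    (τ : X' ⟶ X) (I : X.IdealSheafData) (hτ : IsBlowup τ I) (ϖ : Γ(X, ⊤))
    {C : Set X'} (hC : IsClosed C) (hCirr : IsIrreducible C)
    (hCgen : ¬ C ⊆ τ ⁻¹' X.zeroLocus {ϖ})
    (hCsp : C ∩ τ ⁻¹' X.zeroLocus {ϖ} ⊆ τ ⁻¹' (I.support : Set X)) :
    C ⊆ τ ⁻¹' (I.support : Set X) ∨
      (IsClosed (τ '' C) ∧ IsIrreducible (τ '' C) ∧ ¬ τ '' C ⊆ (I.support : Set X) ∧ ¬ τ '' C ⊆ X.zeroLocus {ϖ} ∧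
        τ '' C ∩ X.zeroLocus {ϖ} ⊆ (I.support : Set X) ∩ X.zeroLocus {ϖ} ∧
        C = closure (τ ⁻¹' (τ '' C \ (I.support : Set X)))) := by
  rcases subset_preimage_support_or_eq_strictTransform τ I hτ hC hCirr with h | ⟨hD, hDirr, hDI, hSt⟩
  · exact Or.inl h
  · refine Or.inr ⟨hD, hDirr, hDI, fun h => hCgen ?_, ?_, hSt⟩
    · rintro c hc
      exact h ⟨c, hc, rfl⟩
    · rintro _ ⟨⟨c, hc, rfl⟩, hcF⟩
      exact ⟨hCsp ⟨hc, hcF⟩, hcF⟩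

/-! ## Scheme-level form in the EL♮ currency -/

/-- **Flat over a DVR ⇒ horizontal.** If `V(C) ↪ Bl → Spec O` is flat (`O` a DVR) and `supp C` is non-empty, then `supp C` is
not contained in the special fibre: flat morphisms are generalising (Mathlib `Flat.generalizingMap`), so the generisation
`η ⤳ s₀` lifts to a point of `V(C)` over the generic point `η ≠ s₀` of `Spec O`. [folklore] -/
theorem not_support_subset_preimage_closedPoint_of_flat {O : Type} [CommRing O] [IsDomain O] [IsDiscreteValuationRing O]
    {Bl : Scheme.{0}} (g : Bl ⟶ Spec (.of O)) (C : Bl.IdealSheafData)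
    (hflat : Flat (CategoryStruct.comp C.subschemeι g)) (hne : (C.support : Set Bl).Nonempty) :
    ¬ (C.support : Set Bl) ⊆ g ⁻¹' {IsLocalRing.closedPoint O} := by
  intro hsub
  obtain ⟨c₀, hc₀⟩ := hne
  obtain ⟨z₀, hz₀⟩ : c₀ ∈ Set.range C.subschemeι := by
    rw [Scheme.IdealSheafData.range_subschemeι]; exact hc₀
  haveI := hflat
  have hgen := Flat.generalizingMap (CategoryStruct.comp C.subschemeι g)
  let η₀ : Spec (.of O) := ⟨⊥, Ideal.isPrime_bot⟩
  have hη : η₀ ⤳ (CategoryStruct.comp C.subschemeι g) z₀ := (PrimeSpectrum.le_iff_specializes η₀ _).mp bot_le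
  obtain ⟨z', -, hz'η⟩ := hgen hη
  have hm : C.subschemeι z' ∈ (C.support : Set Bl) := by
    rw [← Scheme.IdealSheafData.range_subschemeι]; exact ⟨z', rfl⟩
  have h2 : (CategoryStruct.comp C.subschemeι g) z' = IsLocalRing.closedPoint O := by
    have h3 : g (C.subschemeι z') = IsLocalRing.closedPoint O := hsub hm
    rw [Scheme.Hom.comp_apply]
    exact h3
  rw [hz'η] at h2
  exact IsDiscreteValuationRing.not_a_field O (congrArg PrimeSpectrum.asIdeal h2).symm

/-- **[OURS · L1 W4.5(b)] CARRIER DICHOTOMY, scheme-level EL♮ spelling** (CRUX-PLAN v3 §1.7 (b), res-L1-w45b-lead-2's currency):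
`O` a DVR, `r : P → Spec O` with `P` locally Noetherian, `τ : Bl → P` a blow-up along ANY centre `I` (e.g. a curve-centre `C′`),
`C` an ideal sheaf on `Bl` with `V(C)` INTEGRAL and `V(C) ↪ Bl → P → Spec O` FLAT, whose special-fibre points lie in the exceptional
locus `τ⁻¹(supp I)`. Then EITHER `supp C ⊆ τ⁻¹(supp I)` (in-carrier) OR `supp C` is the strict transform
`closure τ⁻¹(D ∖ supp I)` of its image `D = τ(supp C)`, which is closed, irreducible, not inside `supp I`, HORIZONTAL
(`D ⊄ r⁻¹{s₀}`) and has special fibre inside that of the centre (`D ∩ r⁻¹{s₀} ⊆ supp I ∩ r⁻¹{s₀}`). NOT a statement of the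
manuscript. [cite: GortzWedhorn2020, Prop. 13.91 (3)] -/
theorem support_subset_preimage_or_eq_strictTransform_of_flat
    {O : Type} [CommRing O] [IsDomain O] [IsDiscreteValuationRing O] {P Bl : Scheme.{0}} [IsLocallyNoetherian P]
    (r : P ⟶ Spec (.of O)) (τ : Bl ⟶ P) (I : P.IdealSheafData) (hτ : IsBlowup τ I)
    (C : Bl.IdealSheafData) (hCint : IsIntegral C.subscheme)
    (hflat : Flat (CategoryStruct.comp C.subschemeι (CategoryStruct.comp τ r)))
    (hsp : (C.support : Set Bl) ∩ (CategoryStruct.comp τ r) ⁻¹' {IsLocalRing.closedPoint O} ⊆ τ ⁻¹' (I.support : Set P)) :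
    (C.support : Set Bl) ⊆ τ ⁻¹' (I.support : Set P) ∨
      (IsClosed (τ '' (C.support : Set Bl)) ∧ IsIrreducible (τ '' (C.support : Set Bl)) ∧
        ¬ τ '' (C.support : Set Bl) ⊆ (I.support : Set P) ∧
        ¬ τ '' (C.support : Set Bl) ⊆ r ⁻¹' {IsLocalRing.closedPoint O} ∧
        τ '' (C.support : Set Bl) ∩ r ⁻¹' {IsLocalRing.closedPoint O} ⊆
          (I.support : Set P) ∩ r ⁻¹' {IsLocalRing.closedPoint O} ∧
        (C.support : Set Bl) = closure (τ ⁻¹' (τ '' (C.support : Set Bl) \ (I.support : Set P)))) := by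
  obtain ⟨ϖ, hϖ⟩ := IsDiscreteValuationRing.exists_irreducible O
  have hF : P.zeroLocus ({r.appTop ((Scheme.ΓSpecIso (.of O)).inv ϖ)} : Set Γ(P, ⊤)) =
      r ⁻¹' {IsLocalRing.closedPoint O} :=
    zeroLocus_appTop_eq_preimage_closedPoint hϖ r
  have hF' : τ ⁻¹' P.zeroLocus ({r.appTop ((Scheme.ΓSpecIso (.of O)).inv ϖ)} : Set Γ(P, ⊤)) =
      (CategoryStruct.comp τ r) ⁻¹' {IsLocalRing.closedPoint O} := by
    rw [hF]
    ext x
    simp only [Set.mem_preimage, Scheme.Hom.comp_apply]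
  haveI := hCint
  have hCcl : IsClosed (C.support : Set Bl) := C.support.isClosed
  have hCirr : IsIrreducible (C.support : Set Bl) := by
    rw [← Scheme.IdealSheafData.range_subschemeι, ← Set.image_univ]
    exact (IrreducibleSpace.isIrreducible_univ _).image _ C.subschemeι.continuous.continuousOn
  have hCgen : ¬ (C.support : Set Bl) ⊆ τ ⁻¹' P.zeroLocus ({r.appTop ((Scheme.ΓSpecIso (.of O)).inv ϖ)} : Set Γ(P, ⊤)) := by
    rw [hF']
    exact not_support_subset_preimage_closedPoint_of_flat (CategoryStruct.comp τ r) C hflat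
      (by rw [← Scheme.IdealSheafData.range_subschemeι]; exact Set.range_nonempty _)
  have hCsp' : (C.support : Set Bl) ∩ τ ⁻¹' P.zeroLocus ({r.appTop ((Scheme.ΓSpecIso (.of O)).inv ϖ)} : Set Γ(P, ⊤)) ⊆
      τ ⁻¹' (I.support : Set P) := by
    rw [hF']; exact hsp
  rcases subset_preimage_support_or_eq_strictTransform_of_specialFibre_subset τ I hτ _ hCcl hCirr hCgen hCsp' with
    h | ⟨hD, hDirr, hDI, hDgen, hDsp, hSt⟩
  · exact Or.inl h
  · rw [hF] at hDgen hDsp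
    exact Or.inr ⟨hD, hDirr, hDI, hDgen, hDsp, hSt⟩

end Summit.ResolutionOfSingularities.ResolutionOfSingularities.Cruxes.EquisingularLiftNat.Sections
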